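import Literature.Probability.RandomMatrix.LovasAndaiTheorem2Kernel

/-!
# Lovas–Andai 2017, Theorem 2 (`𝒫_sep(ℝ) = 29/64`) — the final integral, part II: eigenvalue triangle

A. Lovas, A. Andai, J. Phys. A 50 (2017) 295303 [LovasAndai2017] (arXiv:1610.01410), proof of
Theorem 2. Part I (`LovasAndaiTheorem2Kernel.lean`) evaluated
`∫₀^∞ χ̃₁(e^{−γ}) dens(γ) dγ = (29/64) ∫₀^∞ dens` for the density `dens = 4 sinh γ · Y₅(γ)`.
This file supplies the change of variables which produces that density from the eigenvalue form
of Lovas–Andai's fibre integral (their eq. (psep) at `𝕂 = ℝ`, `D = ½·1`, after Theorem 1 /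
Corollary 2 and the reduction of `X` to its spectrum `{μ₁ > μ₂} ⊂ (0, ½)`):

* the chart `μ = φ(α) = e^α/(4 cosh α)` of `(0, ½)` (`(½−μ)/μ = e^{−2α}`), the product chart
  `Φ` of the triangle `T = {0 < μ₂ < μ₁ < ½}` by `{β < α}` (`lintegral_image_eq_lintegral_abs_det_fderiv_mul`)
  with `φ'(α)φ'(β) · μ₁μ₂(½−μ₁)(½−μ₂)(μ₁−μ₂) = sinh(α−β) sech⁵α sech⁵β / 16384` and singular-value
  ratio `ε = √(μ₂(½−μ₁)/(μ₁(½−μ₂))) = e^{−(α−β)}` (`jac_mul_eigWeight_PhiChart`, `epsRatio_PhiChart`);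
* the shear `(γ, β) ↦ (γ + β, β)` (`measurePreserving_add_prod`), Tonelli, and the fibre integral
  `∫_ℝ sech⁵(β+γ) sech⁵β dβ = 16 Y₅(γ)` (`integral_fibre`: product-to-sum, translation, scaling);
* hence `lintegral_eigTriangle_eq`: for measurable `f ≥ 0`,
  `∫∫_T f(ε(μ)) w̃(μ) dμ = (1/4096) ∫₀^∞ f(e^{−γ}) dens(γ) dγ`;
* measurability of `χ̃₁` (a parametric integral) and `χ₁(e) = χ₁(1)·χ̃₁(e)` for `0 < e ≤ 1`
  (Lemma 6, tree), and finally **`lintegral_eigTriangle_chiOne`**: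
  `64 · ∫∫_T χ₁(ε(μ)) w̃(μ) dμ = 29 · ∫∫_T χ₁(1) w̃(μ) dμ` in `ℝ≥0∞`, `χ₁ = lovasAndaiChiOne` —
  Lovas–Andai's `𝒫_sep(ℝ) = 29/64` at the level of the eigenvalue integral. Combined with the
  `Z`-section volumes and the Fubini/eigenvalue reduction of the fibre
  (`TwoQubitSeparabilityVolumesRebitFibreSections/Integral.lean`, whose `χ₁` argument
  `√(b(½−a)/(a(½−b)))`, `a ≥ b` the eigenvalues, is literally `epsRatio (a, b)`), this yields the
  fibre fact `LovasAndai2017_rebit_fibre_separability_probability` and, by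
  `TwoQubitSeparabilityVolumesRebitFullProofs.lean`, Theorem 2 on `ℝ⁹`.

## References

* [LovasAndai2017] A. Lovas, A. Andai, J. Phys. A 50 (2017) 295303, §3: Theorem 1, Corollary 2,
  Theorem 2 (proof, p. 8 of arXiv:1610.01410v? — the passage to `(x, y)`, `u, v`, `s, t`).
-/

noncomputable section

namespace Literature.Probability.RandomMatrix.LovasAndai2017

open MeasureTheory Set Filter Topology

/-! ### The logistic chart `μ = e^α/(4 cosh α)` of `(0, ½)` -/

/-- The chart `φ(a) = e^a/(4 cosh a) = (1 + tanh a)/4` of `(0, ½)` by `ℝ`; the eigenvalue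
`μ = φ(a)` of the `X`-block has `(½ − μ)/μ = e^{−2a}`. [folklore] -/
def phiChart (a : ℝ) : ℝ := Real.exp a / (4 * Real.cosh a)

/-- `φ(a) = u²/(2(u² + 1))` with `u = e^a`. [folklore] -/
theorem phiChart_eq (a : ℝ) : phiChart a = Real.exp a ^ 2 / (2 * (Real.exp a ^ 2 + 1)) := by
  have hu : Real.exp a ≠ 0 := (Real.exp_pos a).ne'
  simp only [phiChart, Real.cosh_eq, Real.exp_neg]
  field_simp
  ring

/-- `0 < φ(a)`. [folklore] -/
theorem phiChart_pos (a : ℝ) : 0 < phiChart a := by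
  unfold phiChart; exact div_pos (Real.exp_pos a) (by positivity)

/-- `φ(a) < ½`. [folklore] -/
theorem phiChart_lt_half (a : ℝ) : phiChart a < 1 / 2 := by
  rw [phiChart_eq]
  have hu : 0 < Real.exp a ^ 2 := by positivity
  rw [div_lt_iff₀ (by positivity)]
  nlinarith

/-- `φ` is strictly increasing. [folklore] -/
theorem phiChart_strictMono : StrictMono phiChart := by
  intro a b hab
  rw [phiChart_eq, phiChart_eq]
  have ha : 0 < Real.exp a ^ 2 := by positivity
  have hb : 0 < Real.exp b ^ 2 := by positivity
  have hlt : Real.exp a ^ 2 < Real.exp b ^ 2 := by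
    apply pow_lt_pow_left₀ (Real.exp_lt_exp.2 hab) (Real.exp_pos a).le two_ne_zero
  rw [div_lt_div_iff₀ (by positivity) (by positivity)]
  nlinarith

/-- `φ` is onto `(0, ½)`: `φ(½ log(2m/(1−2m))) = m`. [folklore] -/
theorem phiChart_surj {m : ℝ} (hm0 : 0 < m) (hm1 : m < 1 / 2) : ∃ a, phiChart a = m := by
  refine ⟨Real.log (Real.sqrt (2 * m / (1 - 2 * m))), ?_⟩
  have h12 : 0 < 1 - 2 * m := by linarith
  have hq : 0 < 2 * m / (1 - 2 * m) := by positivity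
  rw [phiChart_eq, Real.exp_log (Real.sqrt_pos.2 hq), Real.sq_sqrt hq.le]
  field_simp
  ring

/-- The derivative `φ'(a) = 1/(4 cosh² a)`. [folklore] -/
theorem hasDerivAt_phiChart (a : ℝ) :
    HasDerivAt phiChart (1 / (4 * Real.cosh a ^ 2)) a := by
  have h1 : HasDerivAt (fun a => 4 * Real.cosh a) (4 * Real.sinh a) a :=
    (Real.hasDerivAt_cosh a).const_mul 4
  have h := (Real.hasDerivAt_exp a).fun_div h1 (by positivity)
  refine h.congr_deriv ?_
  have hc : Real.cosh a ≠ 0 := (Real.cosh_pos a).ne'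
  have hcs : Real.cosh a - Real.sinh a = Real.exp (-a) := Real.cosh_sub_sinh a
  have he : Real.exp a * Real.exp (-a) = 1 := by rw [← Real.exp_add]; simp
  have key : Real.exp a * (4 * Real.cosh a) - Real.exp a * (4 * Real.sinh a) = 4 := by
    have : Real.exp a * (Real.cosh a - Real.sinh a) = 1 := by rw [hcs]; exact he
    linear_combination 4 * this
  rw [key]
  field_simp

/-! ### The product chart of the eigenvalue triangle -/

/-- The eigenvalue triangle `T = {0 < μ₂ < μ₁ < ½}` (ordered spectrum of the `X`-block of a state
in the maximally mixed fibre). [cite: LovasAndai2017, Theorem 2 (proof)] -/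
def eigTriangle : Set (ℝ × ℝ) := {μ | 0 < μ.2 ∧ μ.2 < μ.1 ∧ μ.1 < 1 / 2}

/-- The weight `μ₁μ₂(½−μ₁)(½−μ₂)(μ₁−μ₂)` (`det X · det(½−X)` times the eigenvalue repulsion).
[cite: LovasAndai2017, Theorem 2 (proof)] -/
def eigWeight (μ : ℝ × ℝ) : ℝ := μ.1 * μ.2 * (1 / 2 - μ.1) * (1 / 2 - μ.2) * (μ.1 - μ.2)

/-- The singular-value ratio `ε = σ(V) = √(μ₂(½−μ₁)/(μ₁(½−μ₂)))` of `V = (½−X)^{1/2}X^{-1/2}`,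
`X` with spectrum `{μ₁, μ₂}`. [cite: LovasAndai2017, Lemma 5 and Theorem 1 (σ(V))] -/
def epsRatio (μ : ℝ × ℝ) : ℝ := Real.sqrt (μ.2 * (1 / 2 - μ.1) / (μ.1 * (1 / 2 - μ.2)))

/-- The product chart `Φ(α, β) = (φ α, φ β)`. [folklore] -/
def PhiChart (z : ℝ × ℝ) : ℝ × ℝ := (phiChart z.1, phiChart z.2)

/-- Its derivative `diag(φ'(α), φ'(β))`. [folklore] -/
def fderivPhiChart (z : ℝ × ℝ) : ℝ × ℝ →L[ℝ] ℝ × ℝ :=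
  (Matrix.toLin (.finTwoProd ℝ) (.finTwoProd ℝ)
    !![1 / (4 * Real.cosh z.1 ^ 2), 0; 0, 1 / (4 * Real.cosh z.2 ^ 2)]).toContinuousLinearMap

/-- `Φ` has derivative `fderivPhiChart z` at `z`. [folklore] -/
theorem hasFDerivAt_PhiChart (z : ℝ × ℝ) : HasFDerivAt PhiChart (fderivPhiChart z) z := by
  unfold fderivPhiChart
  rw [Matrix.toLin_finTwoProd_toContinuousLinearMap]
  have h1 := (hasDerivAt_phiChart z.1).comp_hasFDerivAt z (hasFDerivAt_fst (𝕜 := ℝ) (p := z))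
  have h2 := (hasDerivAt_phiChart z.2).comp_hasFDerivAt z (hasFDerivAt_snd (𝕜 := ℝ) (p := z))
  have h : HasFDerivAt PhiChart (((1 / (4 * Real.cosh z.1 ^ 2)) • ContinuousLinearMap.fst ℝ ℝ ℝ).prod
      ((1 / (4 * Real.cosh z.2 ^ 2)) • ContinuousLinearMap.snd ℝ ℝ ℝ)) z :=
    HasFDerivAt.prodMk (𝕜 := ℝ) h1 h2
  have e : (((1 / (4 * Real.cosh z.1 ^ 2)) • ContinuousLinearMap.fst ℝ ℝ ℝ +
      (0 : ℝ) • ContinuousLinearMap.snd ℝ ℝ ℝ).prod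
      ((0 : ℝ) • ContinuousLinearMap.fst ℝ ℝ ℝ + (1 / (4 * Real.cosh z.2 ^ 2)) • ContinuousLinearMap.snd ℝ ℝ ℝ))
      = ((1 / (4 * Real.cosh z.1 ^ 2)) • ContinuousLinearMap.fst ℝ ℝ ℝ).prod
        ((1 / (4 * Real.cosh z.2 ^ 2)) • ContinuousLinearMap.snd ℝ ℝ ℝ) := by
    simp
  rw [e]
  exact h

/-- `det (fderivPhiChart z) = φ'(α) φ'(β)`. [folklore] -/
theorem det_fderivPhiChart (z : ℝ × ℝ) :
    (fderivPhiChart z).det = 1 / (4 * Real.cosh z.1 ^ 2) * (1 / (4 * Real.cosh z.2 ^ 2)) := by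
  unfold fderivPhiChart
  simp only [LinearMap.det_toContinuousLinearMap, LinearMap.det_toLin, Matrix.det_fin_two_of]
  ring

/-- `Φ` is injective. [folklore] -/
theorem PhiChart_injective : Function.Injective PhiChart := by
  rintro ⟨a, b⟩ ⟨a', b'⟩ h
  simp only [PhiChart, Prod.mk.injEq] at h
  obtain ⟨h1, h2⟩ := h
  rw [phiChart_strictMono.injective h1, phiChart_strictMono.injective h2]

/-- `Φ` maps `{β < α}` onto the eigenvalue triangle. [folklore] -/
theorem image_PhiChart : PhiChart '' {z : ℝ × ℝ | z.2 < z.1} = eigTriangle := by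
  ext ⟨m₁, m₂⟩
  constructor
  · rintro ⟨⟨a, b⟩, hab, he⟩
    simp only [mem_setOf_eq] at hab
    simp only [PhiChart, Prod.mk.injEq] at he
    obtain ⟨rfl, rfl⟩ := he
    exact ⟨phiChart_pos b, phiChart_strictMono hab, phiChart_lt_half a⟩
  · rintro ⟨h0, h12, h1⟩
    dsimp only at h0 h12 h1
    obtain ⟨a, ha⟩ := phiChart_surj (h0.trans h12) h1
    obtain ⟨b, hb⟩ := phiChart_surj h0 (h12.trans h1)
    refine ⟨(a, b), ?_, by simp [PhiChart, ha, hb]⟩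
    simp only [mem_setOf_eq]
    by_contra hcon
    push Not at hcon
    have := phiChart_strictMono.monotone hcon
    rw [ha, hb] at this
    linarith

/-- **The weight in the chart**: `φ'(α)φ'(β) · w̃(Φ(α,β)) = sinh(α−β) sech⁵α sech⁵β / 16384`.
[folklore] -/
theorem jac_mul_eigWeight_PhiChart (a b : ℝ) :
    1 / (4 * Real.cosh a ^ 2) * (1 / (4 * Real.cosh b ^ 2)) * eigWeight (PhiChart (a, b)) =
      Real.sinh (a - b) * ((Real.cosh a ^ 5)⁻¹ * (Real.cosh b ^ 5)⁻¹) / 16384 := by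
  simp only [eigWeight, PhiChart, phiChart]
  set u := Real.exp a with hu
  set v := Real.exp b with hv
  have hu0 : u ≠ 0 := (Real.exp_pos a).ne'
  have hv0 : v ≠ 0 := (Real.exp_pos b).ne'
  have hca : Real.cosh a = (u ^ 2 + 1) / (2 * u) := by
    rw [Real.cosh_eq, Real.exp_neg, ← hu]; field_simp
  have hcb : Real.cosh b = (v ^ 2 + 1) / (2 * v) := by
    rw [Real.cosh_eq, Real.exp_neg, ← hv]; field_simp
  have hs : Real.sinh (a - b) = (u ^ 2 - v ^ 2) / (2 * u * v) := by
    rw [Real.sinh_eq, show -(a - b) = b - a by ring, Real.exp_sub, Real.exp_sub, ← hu, ← hv]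
    field_simp
  have hu2 : u ^ 2 + 1 ≠ 0 := by positivity
  have hv2 : v ^ 2 + 1 ≠ 0 := by positivity
  rw [hca, hcb, hs]
  field_simp
  ring

/-- **The singular-value ratio in the chart**: `ε(Φ(α,β)) = e^{−(α−β)}`. [folklore] -/
theorem epsRatio_PhiChart (a b : ℝ) :
    epsRatio (PhiChart (a, b)) = Real.exp (-(a - b)) := by
  simp only [epsRatio, PhiChart, phiChart]
  set u := Real.exp a with hu
  set v := Real.exp b with hv
  have hu0 : 0 < u := Real.exp_pos a
  have hv0 : 0 < v := Real.exp_pos b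
  have hca : Real.cosh a = (u ^ 2 + 1) / (2 * u) := by
    rw [Real.cosh_eq, Real.exp_neg, ← hu]; field_simp
  have hcb : Real.cosh b = (v ^ 2 + 1) / (2 * v) := by
    rw [Real.cosh_eq, Real.exp_neg, ← hv]; field_simp
  have key : v / (4 * Real.cosh b) * (1 / 2 - u / (4 * Real.cosh a)) /
      (u / (4 * Real.cosh a) * (1 / 2 - v / (4 * Real.cosh b))) = (v / u) ^ 2 := by
    rw [hca, hcb]
    field_simp
    ring
  rw [key, Real.sqrt_sq (by positivity), show -(a - b) = b - a by ring, Real.exp_sub]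

/-! ### The `β`-fibre: `∫ sech⁵(β+γ) sech⁵β dβ = 16 Y₅(γ)` -/

/-- Product-to-sum for the fibre integrand:
`(cosh(β+γ) cosh β)⁻⁵ = 32 (cosh(2β+γ) + cosh γ)⁻⁵`. [folklore] -/
theorem inv_cosh_mul_cosh_pow_five (β γ : ℝ) :
    (Real.cosh (β + γ) ^ 5)⁻¹ * (Real.cosh β ^ 5)⁻¹ =
      32 * ((Real.cosh (2 * β + γ) + Real.cosh γ) ^ 5)⁻¹ := by
  have h : Real.cosh (β + γ) * Real.cosh β = (Real.cosh (2 * β + γ) + Real.cosh γ) / 2 := by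
    have h1 := Real.cosh_add (β + γ) β
    have h2 := Real.cosh_sub (β + γ) β
    rw [show β + γ + β = 2 * β + γ by ring] at h1
    rw [show β + γ - β = γ by ring] at h2
    linarith
  have hpos : 0 < Real.cosh (2 * β + γ) + Real.cosh γ := by
    linarith [Real.one_le_cosh (2 * β + γ), Real.one_le_cosh γ]
  rw [← mul_inv, ← mul_pow, h, div_pow]
  field_simp
  norm_num

/-- **The fibre integral**: `∫_ℝ sech⁵(β+γ) sech⁵β dβ = 16 Y₅(γ)` (translate `β ↦ β − γ/2`, scale
by `2`). [folklore] -/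
theorem integral_fibre (γ : ℝ) :
    ∫ β : ℝ, (Real.cosh (β + γ) ^ 5)⁻¹ * (Real.cosh β ^ 5)⁻¹ = 16 * Y 5 γ := by
  simp_rw [inv_cosh_mul_cosh_pow_five]
  rw [integral_const_mul]
  have h1 : ∫ β : ℝ, ((Real.cosh (2 * β + γ) + Real.cosh γ) ^ 5)⁻¹ =
      ∫ β : ℝ, ((Real.cosh (2 * β) + Real.cosh γ) ^ 5)⁻¹ := by
    have := integral_add_right_eq_self (μ := (volume : Measure ℝ))
      (fun β => ((Real.cosh (2 * β) + Real.cosh γ) ^ 5)⁻¹) (γ / 2)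
    rw [← this]
    congr 1; funext β; congr 3; ring
  have h2 : ∫ β : ℝ, ((Real.cosh (2 * β) + Real.cosh γ) ^ 5)⁻¹ =
      |(2 : ℝ)⁻¹| • ∫ θ : ℝ, ((Real.cosh θ + Real.cosh γ) ^ 5)⁻¹ :=
    Measure.integral_comp_mul_left (fun θ => ((Real.cosh θ + Real.cosh γ) ^ 5)⁻¹) 2
  rw [h1, h2]
  simp only [Y, Yc, smul_eq_mul]
  norm_num
  ring

/-- Integrability of the fibre integrand. [folklore] -/
theorem integrable_fibre (γ : ℝ) :
    Integrable fun β : ℝ => (Real.cosh (β + γ) ^ 5)⁻¹ * (Real.cosh β ^ 5)⁻¹ := by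
  simp_rw [inv_cosh_mul_cosh_pow_five]
  refine Integrable.const_mul ?_ _
  have hcont : Continuous fun β : ℝ => ((Real.cosh (2 * β + γ) + Real.cosh γ) ^ 5)⁻¹ := by
    refine Continuous.inv₀ (by fun_prop) fun β => ?_
    exact pow_ne_zero _ (by linarith [Real.one_le_cosh (2 * β + γ), Real.one_le_cosh γ] :
      Real.cosh (2 * β + γ) + Real.cosh γ ≠ 0)
  refine Integrable.mono' ((integrable_inv_one_add_sq).const_mul 2) hcont.aestronglyMeasurable
    (Eventually.of_forall fun β => ?_)
  have hD : 1 ≤ Real.cosh (2 * β + γ) + Real.cosh γ := by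
    linarith [Real.one_le_cosh (2 * β + γ), Real.one_le_cosh γ]
  have hnn : 0 ≤ ((Real.cosh (2 * β + γ) + Real.cosh γ) ^ 5)⁻¹ := inv_nonneg.2 (by positivity)
  rw [Real.norm_eq_abs, abs_of_nonneg hnn]
  -- (cosh(2β+γ) + cosh γ)^5 ≥ cosh(2β+γ)+cosh γ ≥ cosh(2β) ≥ (1 + (2β)²)/2 ≥ (1+β²)/2
  have hc : (1 + β ^ 2) / 2 ≤ Real.cosh (2 * β + γ) + Real.cosh γ := by
    have h1 : (1 + (2 * β + γ) ^ 2) / 2 ≤ Real.cosh (2 * β + γ) + 0 :=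
      half_one_add_sq_le_cosh_add (2 * β + γ) le_rfl
    have h2 : (1 + γ ^ 2) / 2 ≤ Real.cosh γ + 0 := half_one_add_sq_le_cosh_add γ le_rfl
    nlinarith [sq_nonneg (β + γ), sq_nonneg (2 * β + γ), sq_nonneg γ, sq_nonneg β]
  have hpow : Real.cosh (2 * β + γ) + Real.cosh γ ≤ (Real.cosh (2 * β + γ) + Real.cosh γ) ^ 5 := by
    calc Real.cosh (2 * β + γ) + Real.cosh γ = (Real.cosh (2 * β + γ) + Real.cosh γ) ^ 1 := (pow_one _).symm
      _ ≤ _ := pow_le_pow_right₀ hD (by norm_num)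
  rw [show 2 * (1 + β ^ 2)⁻¹ = ((1 + β ^ 2) / 2)⁻¹ by
    have : (0:ℝ) < 1 + β ^ 2 := by positivity
    field_simp]
  exact inv_anti₀ (by positivity) (hc.trans hpow)

/-- The fibre integral as a lower Lebesgue integral: `∫⁻ sech⁵(β+γ)sech⁵β = ofReal (16 Y₅ γ)`.
[folklore] -/
theorem lintegral_fibre (γ : ℝ) :
    ∫⁻ β : ℝ, ENNReal.ofReal ((Real.cosh (β + γ) ^ 5)⁻¹ * (Real.cosh β ^ 5)⁻¹) =
      ENNReal.ofReal (16 * Y 5 γ) := by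
  rw [← integral_fibre, ofReal_integral_eq_lintegral_ofReal (integrable_fibre γ)]
  exact Eventually.of_forall fun β => mul_nonneg (inv_nonneg.2 (by positivity))
    (inv_nonneg.2 (by positivity))

/-! ### The change of variables -/

/-- Measurability of the triangle. [folklore] -/
theorem measurableSet_lt_fst_snd : MeasurableSet {z : ℝ × ℝ | z.2 < z.1} :=
  measurableSet_lt measurable_snd measurable_fst

/-- **Change of variables to the singular-value ratio.** For every measurable `f : ℝ → [0,∞]`,
`∫∫_{0<μ₂<μ₁<½} f(ε(μ)) μ₁μ₂(½−μ₁)(½−μ₂)(μ₁−μ₂) dμ = (1/4096) ∫₀^∞ f(e^{−γ}) dens(γ) dγ`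
(`μᵢ = φ(αᵢ)`, `γ = α₁ − α₂`, the fibre integral `16 Y₅`, `dens = 4 sinh γ Y₅ γ`). This is the
passage "polar coordinates + `u = (1−x)/(1+x)`, `v = (1−y)/(1+y)`, `u = ts`, `v = s/t`" of the
printed proof, with `t = e^{−γ}`. [cite: LovasAndai2017, Theorem 2 (proof), our reorganisation] -/
theorem lintegral_eigTriangle_eq (f : ℝ → ENNReal) (hf : Measurable f) :
    ∫⁻ μ in eigTriangle, f (epsRatio μ) * ENNReal.ofReal (eigWeight μ) =
      ENNReal.ofReal (1 / 4096) * ∫⁻ γ in Ioi (0:ℝ), f (Real.exp (-γ)) * ENNReal.ofReal (dens γ) := by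
  -- Step 1: the product chart
  have hS := measurableSet_lt_fst_snd
  rw [← image_PhiChart,
    lintegral_image_eq_lintegral_abs_det_fderiv_mul volume hS
      (fun z _ => (hasFDerivAt_PhiChart z).hasFDerivWithinAt) PhiChart_injective.injOn]
  have step1 : ∀ z ∈ {z : ℝ × ℝ | z.2 < z.1},
      ENNReal.ofReal |(fderivPhiChart z).det| * (f (epsRatio (PhiChart z)) * ENNReal.ofReal (eigWeight (PhiChart z)))
        = f (Real.exp (-(z.1 - z.2))) *
          ENNReal.ofReal (Real.sinh (z.1 - z.2) * ((Real.cosh z.1 ^ 5)⁻¹ * (Real.cosh z.2 ^ 5)⁻¹) / 16384) := by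
    rintro ⟨a, b⟩ hab
    simp only [mem_setOf_eq] at hab
    have hdet := det_fderivPhiChart (a, b)
    have hdet0 : 0 ≤ (fderivPhiChart (a, b)).det := by rw [hdet]; positivity
    rw [abs_of_nonneg hdet0, epsRatio_PhiChart a b]
    have hw := jac_mul_eigWeight_PhiChart a b
    dsimp only
    rw [mul_comm (ENNReal.ofReal _), mul_assoc, ← ENNReal.ofReal_mul (by
      have := (phiChart_pos a); simp only [eigWeight, PhiChart]
      have h1 := phiChart_pos b; have h2 := phiChart_lt_half a; have h3 := phiChart_lt_half b
      have h4 := phiChart_strictMono hab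
      have : 0 ≤ phiChart a * phiChart b * (1 / 2 - phiChart a) * (1 / 2 - phiChart b) *
        (phiChart a - phiChart b) := by
        apply mul_nonneg (mul_nonneg (mul_nonneg (mul_nonneg _ _) _) _) _ <;> linarith
      exact this), mul_comm (eigWeight _), hdet, hw]
  rw [setLIntegral_congr_fun hS step1]
  -- Step 2: the shear `(γ, β) ↦ (γ + β, β)`
  have hshear : MeasurePreserving (fun z : ℝ × ℝ => (z.1 + z.2, z.2))
      (volume : Measure (ℝ × ℝ)) volume := by
    have := measurePreserving_add_prod (volume : Measure ℝ) (volume : Measure ℝ)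
    rwa [← Measure.volume_eq_prod] at this
  set G : ℝ × ℝ → ENNReal := fun z => f (Real.exp (-(z.1 - z.2))) *
    ENNReal.ofReal (Real.sinh (z.1 - z.2) * ((Real.cosh z.1 ^ 5)⁻¹ * (Real.cosh z.2 ^ 5)⁻¹) / 16384)
    with hG
  have hGm : Measurable G := by
    apply Measurable.mul
    · exact hf.comp (by fun_prop)
    · exact ENNReal.measurable_ofReal.comp (by fun_prop)
  have hpre : (fun z : ℝ × ℝ => (z.1 + z.2, z.2)) ⁻¹' {z : ℝ × ℝ | z.2 < z.1} = Ioi (0:ℝ) ×ˢ univ := by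
    ext ⟨g, b⟩; simp
  have step2 := hshear.setLIntegral_comp_preimage hS hGm
  rw [hpre] at step2
  rw [show (∫⁻ z in {z : ℝ × ℝ | z.2 < z.1}, f (Real.exp (-(z.1 - z.2))) *
      ENNReal.ofReal (Real.sinh (z.1 - z.2) * ((Real.cosh z.1 ^ 5)⁻¹ * (Real.cosh z.2 ^ 5)⁻¹) / 16384))
      = ∫⁻ z in {z : ℝ × ℝ | z.2 < z.1}, G z from rfl, ← step2]
  -- Step 3: Tonelli on `Ioi 0 ×ˢ univ`
  have hGm' : AEMeasurable (fun z : ℝ × ℝ => G (z.1 + z.2, z.2))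
      (((volume : Measure ℝ).prod volume).restrict (Ioi 0 ×ˢ univ)) :=
    (hGm.comp (by fun_prop)).aemeasurable
  rw [Measure.volume_eq_prod, setLIntegral_prod _ hGm']
  simp only [hG, add_sub_cancel_right, Measure.restrict_univ]
  -- Step 4: the fibre integral
  have hmeasβ : ∀ γ : ℝ, Measurable fun β : ℝ =>
      ENNReal.ofReal ((Real.cosh (γ + β) ^ 5)⁻¹ * (Real.cosh β ^ 5)⁻¹) := fun γ =>
    ENNReal.measurable_ofReal.comp (by fun_prop)
  have step4 : ∀ γ ∈ Ioi (0:ℝ), ∫⁻ β : ℝ, f (Real.exp (-γ)) *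
      ENNReal.ofReal (Real.sinh γ * ((Real.cosh (γ + β) ^ 5)⁻¹ * (Real.cosh β ^ 5)⁻¹) / 16384) =
      ENNReal.ofReal (1 / 4096) * (f (Real.exp (-γ)) * ENNReal.ofReal (dens γ)) := by
    intro γ hγ
    have hγ' : 0 < γ := hγ
    have hs : 0 ≤ Real.sinh γ := Real.sinh_nonneg_iff.2 hγ'.le
    have hsplit : ∀ β : ℝ, ENNReal.ofReal (Real.sinh γ *
        ((Real.cosh (γ + β) ^ 5)⁻¹ * (Real.cosh β ^ 5)⁻¹) / 16384) =
        ENNReal.ofReal (Real.sinh γ / 16384) *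
          ENNReal.ofReal ((Real.cosh (γ + β) ^ 5)⁻¹ * (Real.cosh β ^ 5)⁻¹) := by
      intro β
      rw [← ENNReal.ofReal_mul (by positivity)]
      congr 1; ring
    simp_rw [hsplit]
    rw [lintegral_const_mul _ ((hmeasβ γ).const_mul _), lintegral_const_mul _ (hmeasβ γ)]
    have hfib := lintegral_fibre γ
    simp_rw [add_comm _ γ] at hfib
    rw [hfib, ← ENNReal.ofReal_mul (by positivity)]
    rw [show Real.sinh γ / 16384 * (16 * Y 5 γ) = 1 / 4096 * dens γ by simp only [dens]; ring,
      ENNReal.ofReal_mul (by norm_num : (0:ℝ) ≤ 1 / 4096)]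
    ring
  rw [setLIntegral_congr_fun measurableSet_Ioi step4]
  rw [lintegral_const_mul]
  exact (hf.comp (by fun_prop)).mul (ENNReal.measurable_ofReal.comp continuous_dens.measurable)

/-! ### Measurability and range of `χ̃₁` -/

/-- The Lemma-6 integrand is measurable. [folklore] -/
theorem measurable_kfun : Measurable kfun := by
  unfold kfun
  fun_prop

/-- `K` is measurable (a parametric integral of a jointly measurable integrand). [folklore] -/
theorem measurable_Kfun : Measurable Kfun := by
  set F : ℝ × ℝ → ℝ := Set.indicator {p : ℝ × ℝ | p.2 ∈ Ioc 0 p.1} (fun p => kfun p.2) with hFdef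
  have hS : MeasurableSet {p : ℝ × ℝ | p.2 ∈ Ioc 0 p.1} := by
    have : {p : ℝ × ℝ | p.2 ∈ Ioc 0 p.1} = {p | 0 < p.2} ∩ {p | p.2 ≤ p.1} := by
      ext p; simp [mem_Ioc]
    rw [this]
    exact (measurableSet_lt measurable_const measurable_snd).inter
      (measurableSet_le measurable_snd measurable_fst)
  have hF : StronglyMeasurable F :=
    ((measurable_kfun.comp measurable_snd).indicator hS).stronglyMeasurable
  have h := hF.integral_prod_right' (ν := (volume : Measure ℝ))
  have hK : Kfun = fun e => ∫ s, F (e, s) := by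
    funext e
    simp only [Kfun, hFdef]
    rw [← integral_indicator measurableSet_Ioc]
    congr 1
  rw [hK]
  exact h.measurable

/-- `χ̃₁` is measurable. [folklore] -/
theorem measurable_chiTilde : Measurable chiTilde :=
  measurable_Kfun.const_mul _

/-- `χ₁(e) ≤ χ₁(1)` (the defining set of `χ₁(e)` is cut out of the unit ball, which is the set of
`χ₁(1)`). [cite: LovasAndai2017, Definition 1] -/
theorem lovasAndaiChiOne_le_chiOne_one (e : ℝ) : lovasAndaiChiOne e ≤ lovasAndaiChiOne 1 := by
  rw [lovasAndaiChiOne_one_eq]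
  exact measure_mono fun z hz => hz.1

/-- `χ₁(1) = 2π²/3` is finite and non-zero. [cite: LovasAndai2017, §5] -/
theorem lovasAndaiChiOne_one_ne_top : lovasAndaiChiOne 1 ≠ ⊤ := by
  rw [LovasAndaiLemma6.lovasAndaiChiOne_one]; exact ENNReal.ofReal_ne_top

/-- `(χ₁(1)).toReal > 0`. [cite: LovasAndai2017, §5] -/
theorem lovasAndaiChiOne_one_toReal_pos : 0 < (lovasAndaiChiOne 1).toReal := by
  rw [LovasAndaiLemma6.lovasAndaiChiOne_one, ENNReal.toReal_ofReal (by positivity)]; positivity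

/-- `0 ≤ χ̃₁(e) ≤ 1` for `0 < e ≤ 1`. [cite: LovasAndai2017, Lemma 6] -/
theorem chiTilde_mem_Icc {e : ℝ} (he0 : 0 < e) (he1 : e ≤ 1) : chiTilde e ∈ Icc (0:ℝ) 1 := by
  rw [chiTilde_eq_div he0 he1]
  have hpos := lovasAndaiChiOne_one_toReal_pos
  refine ⟨div_nonneg ENNReal.toReal_nonneg hpos.le, ?_⟩
  rw [div_le_one hpos]
  exact ENNReal.toReal_mono lovasAndaiChiOne_one_ne_top (lovasAndaiChiOne_le_chiOne_one e)

/-- `χ₁(e) = χ₁(1) · χ̃₁(e)` in `ℝ≥0∞` for `0 < e ≤ 1`. [cite: LovasAndai2017, Lemma 6] -/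
theorem lovasAndaiChiOne_eq_mul_chiTilde {e : ℝ} (he0 : 0 < e) (he1 : e ≤ 1) :
    lovasAndaiChiOne e = lovasAndaiChiOne 1 * ENNReal.ofReal (chiTilde e) := by
  have hfin : lovasAndaiChiOne e ≠ ⊤ :=
    ne_top_of_le_ne_top lovasAndaiChiOne_one_ne_top (lovasAndaiChiOne_le_chiOne_one e)
  have hpos := lovasAndaiChiOne_one_toReal_pos
  have h := chiTilde_eq_div he0 he1
  have h2 : (lovasAndaiChiOne e).toReal = (lovasAndaiChiOne 1).toReal * chiTilde e := by
    rw [h]; field_simp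
  rw [← ENNReal.ofReal_toReal hfin, h2, ENNReal.ofReal_mul ENNReal.toReal_nonneg,
    ENNReal.ofReal_toReal lovasAndaiChiOne_one_ne_top]

/-! ### The interface theorem: the ratio `29/64` on the eigenvalue triangle -/

/-- On the triangle the singular-value ratio lies in `(0, 1]`. [folklore] -/
theorem epsRatio_mem {μ : ℝ × ℝ} (hμ : μ ∈ eigTriangle) : 0 < epsRatio μ ∧ epsRatio μ ≤ 1 := by
  obtain ⟨h0, h12, h1⟩ := hμ
  have hnum : 0 < μ.2 * (1 / 2 - μ.1) := mul_pos h0 (by linarith)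
  have hden : 0 < μ.1 * (1 / 2 - μ.2) := mul_pos (h0.trans h12) (by linarith)
  have hq : 0 < μ.2 * (1 / 2 - μ.1) / (μ.1 * (1 / 2 - μ.2)) := div_pos hnum hden
  refine ⟨Real.sqrt_pos.2 hq, ?_⟩
  rw [epsRatio, Real.sqrt_le_one]
  rw [div_le_one hden]
  nlinarith

/-- `epsRatio` is measurable. [folklore] -/
theorem measurable_epsRatio : Measurable epsRatio := by
  unfold epsRatio; fun_prop

/-- `eigWeight` is measurable. [folklore] -/
theorem measurable_eigWeight : Measurable eigWeight := by
  unfold eigWeight; fun_prop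

/-- The triangle is measurable. [folklore] -/
theorem measurableSet_eigTriangle : MeasurableSet eigTriangle := by
  have : eigTriangle = {μ : ℝ × ℝ | 0 < μ.2} ∩ {μ | μ.2 < μ.1} ∩ {μ | μ.1 < 1 / 2} := by
    ext μ; simp [eigTriangle, and_assoc]
  rw [this]
  exact ((measurableSet_lt measurable_const measurable_snd).inter
    (measurableSet_lt measurable_snd measurable_fst)).inter (measurableSet_lt measurable_fst measurable_const)

/-- `χ̃₁(e^{−γ}) dens(γ)` is integrable on `(0, ∞)`. [folklore] -/
theorem integrableOn_chiTilde_mul_dens :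
    IntegrableOn (fun γ => chiTilde (Real.exp (-γ)) * dens γ) (Ioi 0) := by
  refine Integrable.mono' integrableOn_dens
    ((measurable_chiTilde.comp (by fun_prop)).aestronglyMeasurable.mul
      continuous_dens.aestronglyMeasurable) ?_
  refine (ae_restrict_iff' measurableSet_Ioi).2 (Eventually.of_forall fun γ hγ => ?_)
  have hγ' : 0 < γ := hγ
  have hb := chiTilde_mem_Icc (Real.exp_pos (-γ)) (by rw [Real.exp_le_one_iff]; linarith)
  rw [norm_mul, Real.norm_eq_abs, Real.norm_eq_abs, abs_of_nonneg hb.1,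
    abs_of_nonneg (dens_nonneg hγ'.le)]
  calc chiTilde (Real.exp (-γ)) * dens γ ≤ 1 * dens γ :=
        mul_le_mul_of_nonneg_right hb.2 (dens_nonneg hγ'.le)
    _ = dens γ := one_mul _

/-- **Lovas–Andai's Theorem 2 on the eigenvalue triangle.** With `χ₁ = lovasAndaiChiOne` (the
volume of the doubly constrained operator-norm ball, [LovasAndai2017, Def. 1]) and the weight
`w̃(μ) = μ₁μ₂(½−μ₁)(½−μ₂)(μ₁−μ₂)` on `T = {0 < μ₂ < μ₁ < ½}`:
`64 · ∫∫_T χ₁(ε(μ)) w̃(μ) dμ = 29 · ∫∫_T χ₁(1) w̃(μ) dμ`, i.e. the ratio of [LovasAndai2017,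
eq. (psep) for `𝕂 = ℝ`] is `29/64` [LovasAndai2017, Theorem 2]. Ingredients: Lemma 6 (tree),
`lintegral_eigTriangle_eq`, `integral_chiTilde_mul_dens_eq`.
[cite: LovasAndai2017, Theorem 2] -/
theorem lintegral_eigTriangle_chiOne :
    64 * ∫⁻ μ in eigTriangle, lovasAndaiChiOne (epsRatio μ) * ENNReal.ofReal (eigWeight μ) =
      29 * ∫⁻ μ in eigTriangle, lovasAndaiChiOne 1 * ENNReal.ofReal (eigWeight μ) := by
  -- pointwise rewriting through Lemma 6
  have hpt : ∀ μ ∈ eigTriangle, lovasAndaiChiOne (epsRatio μ) * ENNReal.ofReal (eigWeight μ) =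
      lovasAndaiChiOne 1 * ((fun e => ENNReal.ofReal (chiTilde e)) (epsRatio μ) *
        ENNReal.ofReal (eigWeight μ)) := by
    intro μ hμ
    obtain ⟨h0, h1⟩ := epsRatio_mem hμ
    rw [lovasAndaiChiOne_eq_mul_chiTilde h0 h1, mul_assoc]
  rw [setLIntegral_congr_fun measurableSet_eigTriangle hpt]
  have hm1 : Measurable fun μ : ℝ × ℝ => (fun e => ENNReal.ofReal (chiTilde e)) (epsRatio μ) *
      ENNReal.ofReal (eigWeight μ) :=
    ((ENNReal.measurable_ofReal.comp measurable_chiTilde).comp measurable_epsRatio).mul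
      (ENNReal.measurable_ofReal.comp measurable_eigWeight)
  rw [lintegral_const_mul _ hm1]
  rw [lintegral_eigTriangle_eq (fun e => ENNReal.ofReal (chiTilde e))
    (ENNReal.measurable_ofReal.comp measurable_chiTilde)]
  -- the constant integrand
  have hm2 : Measurable fun μ : ℝ × ℝ => (fun _ : ℝ => (1 : ENNReal)) (epsRatio μ) *
      ENNReal.ofReal (eigWeight μ) :=
    measurable_const.mul (ENNReal.measurable_ofReal.comp measurable_eigWeight)
  have hone : ∫⁻ μ in eigTriangle, lovasAndaiChiOne 1 * ENNReal.ofReal (eigWeight μ) =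
      lovasAndaiChiOne 1 * ∫⁻ μ in eigTriangle, (fun _ : ℝ => (1 : ENNReal)) (epsRatio μ) *
        ENNReal.ofReal (eigWeight μ) := by
    rw [← lintegral_const_mul _ hm2]
    simp
  rw [hone, lintegral_eigTriangle_eq (fun _ => (1 : ENNReal)) measurable_const]
  simp only [one_mul]
  -- the two `γ`-integrals
  have hnum : ∫⁻ γ in Ioi (0:ℝ), ENNReal.ofReal (chiTilde (Real.exp (-γ))) * ENNReal.ofReal (dens γ) =
      ENNReal.ofReal (29 / 64) * ENNReal.ofReal (∫ γ in Ioi 0, dens γ) := by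
    have h1 : ∫⁻ γ in Ioi (0:ℝ), ENNReal.ofReal (chiTilde (Real.exp (-γ))) * ENNReal.ofReal (dens γ) =
        ∫⁻ γ in Ioi (0:ℝ), ENNReal.ofReal (chiTilde (Real.exp (-γ)) * dens γ) := by
      refine setLIntegral_congr_fun measurableSet_Ioi fun γ hγ => ?_
      have hγ' : 0 < γ := hγ
      have hb := chiTilde_mem_Icc (Real.exp_pos (-γ)) (by rw [Real.exp_le_one_iff]; linarith)
      rw [← ENNReal.ofReal_mul hb.1]
    rw [h1, ← ofReal_integral_eq_lintegral_ofReal integrableOn_chiTilde_mul_dens, integral_chiTilde_mul_dens_eq,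
      ENNReal.ofReal_mul (by norm_num)]
    refine (ae_restrict_iff' measurableSet_Ioi).2 (Eventually.of_forall fun γ hγ => ?_)
    have hγ' : 0 < γ := hγ
    have hb := chiTilde_mem_Icc (Real.exp_pos (-γ)) (by rw [Real.exp_le_one_iff]; linarith)
    exact mul_nonneg hb.1 (dens_nonneg hγ'.le)
  have hden : ∫⁻ γ in Ioi (0:ℝ), ENNReal.ofReal (dens γ) = ENNReal.ofReal (∫ γ in Ioi 0, dens γ) := by
    rw [← ofReal_integral_eq_lintegral_ofReal integrableOn_dens]
    exact (ae_restrict_iff' measurableSet_Ioi).2 (Eventually.of_forall fun γ hγ => dens_nonneg (le_of_lt hγ))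
  rw [hnum, hden]
  have h64 : (64 : ENNReal) * ENNReal.ofReal (29 / 64) = 29 := by
    rw [show (64 : ENNReal) = ENNReal.ofReal 64 by simp, ← ENNReal.ofReal_mul (by norm_num)]
    norm_num
  calc (64 : ENNReal) * (lovasAndaiChiOne 1 * (ENNReal.ofReal (1 / 4096) *
        (ENNReal.ofReal (29 / 64) * ENNReal.ofReal (∫ γ in Ioi 0, dens γ))))
      = (64 * ENNReal.ofReal (29 / 64)) * (lovasAndaiChiOne 1 * (ENNReal.ofReal (1 / 4096) *
          ENNReal.ofReal (∫ γ in Ioi 0, dens γ))) := by ring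
    _ = 29 * (lovasAndaiChiOne 1 * (ENNReal.ofReal (1 / 4096) *
          ENNReal.ofReal (∫ γ in Ioi 0, dens γ))) := by rw [h64]

end Literature.Probability.RandomMatrix.LovasAndai2017

end
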